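import Literature.Barriers.RiemannHypothesis.EpsteinZetaRealZerosDHOddLimits
import Literature.Barriers.RiemannHypothesis.EpsteinZetaRealZerosDHOddAnalytic
import Literature.Barriers.RiemannHypothesis.EpsteinZetaRealZerosDHTwistFamily
import Literature.Barriers.RiemannHypothesis.EpsteinZetaRealZerosDHSelect
import Literature.Barriers.RiemannHypothesis.EpsteinZetaRealZerosDHShifts
import HarnessLib

/-!
# Davenport–Heilbronn for Epstein zeta functions, XIV: the odd class number case
# (Davenport–Heilbronn II, Lemma 2 and the Theorem)

Sibling of `Literature/Barriers/RiemannHypothesis/EpsteinZetaRealZeros.lean` (named fact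
`DavenportHeilbronn1936b_epstein`). Everything in this file is PROVED; no definitions, no named facts.

Davenport–Heilbronn II, §5 Lemma 2: "For any given `δ > 0` there is a set of numbers `a(p)` with
`|a(p)| = 1` such that `F_a(s)` has a zero in `1 < s < 1 + δ`"; §6 Theorem: "If `d` is a negative
fundamental discriminant and `h(d)` is odd and different from `1`, then `ζ(s, Q)` has an infinity
of zeros for `σ > 1`" ("The theorem follows from Lemma 2 by the same application of Kronecker's
theorem as was made in our previous paper").

Here Lemma 2 is proved (`exists_real_zero_twistModel_of_odd`) for the lattice-ideal form
`Q = (A, t − 2k, C)` of an imaginary quadratic field `K` (`[K:ℚ] = 2`, `d_K < −4`) with `h_K` odd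
and `> 1`, by the tree's variant of D–H's construction which needs only the Dirichlet densities of
the ideal classes (not the prime number theorem for classes used for D–H's inductive choice (12)):
the unimodular completely multiplicative `a = complMul (p ↦ e^{iθ(p)})` has `a(p) = i` except on
finitely many split primes, where finitely many real flips `a(p) = ±1` steer the moduli of the
`M(1⁺, χ)` (boosting one pair `χ*, χ̄*` by the profile `t_g = T₀ ℜχ*(g) + T₁` and orthogonality,
`sum_re_toMulHom_mul_re`, and centring `|M(1⁺, χ₀)|` against it), and one split prime `p₁` carries
a free phase `a(p₁) = e^{iφ}`; the zero is then produced by `exists_zero_phase_family`. With the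
analytic half (`davenportHeilbronn_conclusion_of_twist_zero`) this gives the Theorem with
Titchmarsh's `≫ T` count: `davenportHeilbronn_conclusion_of_odd_card`.

## References

* [DavenportHeilbronn1936b] H. Davenport, H. Heilbronn, *On the zeros of certain Dirichlet
  series II*, J. London Math. Soc. 11 (1936), 307–312, §5 Lemma 2, §6 Theorem.
* [Titchmarsh1986] E. C. Titchmarsh, *The Theory of the Riemann Zeta-Function*, 2nd ed., §10.25.
-/

noncomputable section

open Filter Topology Complex NumberField IsDedekindDomain Module Set
open Literature.NumberTheory.LFunctions Literature.NumberTheory.LFunctions.AbelianDensity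
open Literature.NumberTheory.QuadraticFields.Quadratic
open scoped nonZeroDivisors ComplexConjugate Classical

namespace Literature.Barriers.RiemannHypothesis

namespace DHEpstein

variable {K : Type*} [Field K] [NumberField K]

/-! ## Helpers -/

/-- `p^{-s} ≤ 1/2` for `p ≥ 4`, `s ≥ 1/2`, and `p^{-s} > 0`. [folklore] -/
theorem rpow_neg_le_half {p : ℕ} (hp : 4 ≤ p) {s : ℝ} (hs : 1 / 2 ≤ s) :
    0 < (p : ℝ) ^ (-s) ∧ (p : ℝ) ^ (-s) ≤ 1 / 2 := by
  have hp0 : (0 : ℝ) < p := by exact_mod_cast (show 0 < p by omega)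
  have hp1 : (1 : ℝ) ≤ p := by exact_mod_cast (show 1 ≤ p by omega)
  refine ⟨Real.rpow_pos_of_pos hp0 _, ?_⟩
  calc (p : ℝ) ^ (-s) ≤ (p : ℝ) ^ (-(1 / 2 : ℝ)) := Real.rpow_le_rpow_of_exponent_le hp1 (by linarith)
    _ ≤ (4 : ℝ) ^ (-(1 / 2 : ℝ)) :=
        Real.rpow_le_rpow_of_nonpos (by norm_num) (by exact_mod_cast hp) (by norm_num)
    _ = 1 / 2 := by
        rw [Real.rpow_neg (by norm_num), show (4 : ℝ) = 2 ^ (2 : ℝ) by norm_num,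
          ← Real.rpow_mul (by norm_num)]
        norm_num

/-- Continuity in `s > 1/2` of the local logarithm `s ↦ −log(1 − c p^{-s} e^{iψ})` (`|c| = 1`,
`p ≥ 4`). [folklore] -/
theorem continuousOn_locLog_rpow {c : ℂ} (hc : ‖c‖ = 1) {p : ℕ} (hp : 4 ≤ p) (ψ : ℝ) :
    ContinuousOn (fun s : ℝ ↦ -Complex.log (1 - c * (((p : ℝ) ^ (-s) : ℝ) : ℂ) * cexp (ψ * I))) (Ioi (1 / 2)) := by
  have hp0 : (0 : ℝ) < p := by exact_mod_cast (show 0 < p by omega)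
  have hrp : Continuous fun s : ℝ ↦ (p : ℝ) ^ (-s) := (Real.continuous_const_rpow hp0.ne').comp continuous_neg
  have h1 : Continuous fun s : ℝ ↦ (((p : ℝ) ^ (-s), ψ) : ℝ × ℝ) := hrp.prodMk continuous_const
  have hmaps : MapsTo (fun s : ℝ ↦ (((p : ℝ) ^ (-s), ψ) : ℝ × ℝ)) (Ioi (1 / 2)) (Icc 0 (1 / 2) ×ˢ univ) := by
    intro s hs
    rw [Set.mem_Ioi] at hs
    obtain ⟨h0, hle⟩ := rpow_neg_le_half hp hs.le
    exact Set.mk_mem_prod ⟨h0.le, hle⟩ (mem_univ _)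
  have h := (continuousOn_locLog_two hc).comp h1.continuousOn hmaps
  refine h.congr fun s _ ↦ ?_
  simp only [Function.comp_apply]

/-- Splitting a sum over the characters off three distinct ones. [folklore] -/
theorem sum_eq_add_add_add_sum_erase {ι : Type*} [Fintype ι] [DecidableEq ι] (f : ι → ℂ)
    {a b c : ι} (hab : b ≠ a) (hac : c ≠ a) (hbc : c ≠ b) :
    ∑ i, f i = f a + f b + f c + ∑ i ∈ ((Finset.univ.erase a).erase b).erase c, f i := by
  rw [← Finset.add_sum_erase _ _ (Finset.mem_univ a),
    ← Finset.add_sum_erase _ _ (Finset.mem_erase.2 ⟨hab, Finset.mem_univ b⟩),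
    ← Finset.add_sum_erase _ _ (Finset.mem_erase.2 ⟨hbc, Finset.mem_erase.2 ⟨hac, Finset.mem_univ c⟩⟩)]
  ring

/-- `|−log(1 − c x e^{iψ})| ≤ (3/2) x` for `|c| = 1`, `0 ≤ x ≤ 1/2`. [folklore] -/
theorem norm_locLog_le {c : ℂ} (hc : ‖c‖ = 1) {x : ℝ} (hx0 : 0 ≤ x) (hx : x ≤ 1 / 2) (ψ : ℝ) :
    ‖-Complex.log (1 - c * x * cexp (ψ * I))‖ ≤ 3 / 2 * x := by
  have h := norm_neg_log_one_sub_le (z := c * x * cexp (ψ * I)) (by rw [norm_mul_mul_cexp hc hx0]; exact hx)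
  rwa [norm_mul_mul_cexp hc hx0] at h

/-- A six-term triangle inequality. [folklore] -/
theorem norm_add_sub_sub_sub_sub_le (a b c d e f : ℂ) :
    ‖a + b - c - d - e - f‖ ≤ ‖a‖ + ‖b‖ + ‖c‖ + ‖d‖ + ‖e‖ + ‖f‖ := by
  have h1 := norm_sub_le (a + b - c - d - e) f
  have h2 := norm_sub_le (a + b - c - d) e
  have h3 := norm_sub_le (a + b - c) d
  have h4 := norm_sub_le (a + b) c
  have h5 := norm_add_le a b
  linarith

/-! ## Davenport–Heilbronn II, Lemma 2 -/

-- the assembly carries a large context (characters, primes, thresholds, limits, constants)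
set_option maxHeartbeats 1600000 in
/-- **Davenport–Heilbronn II, Lemma 2 (tree variant).** Let `K` be an imaginary quadratic field
(`[K:ℚ] = 2`) with integral basis `(1, ω)`, `ω² = m + tω`, `t² + 4m < −4`, and `h_K` odd and `> 1`;
let `A > 0`, `AC = k² − tk − m`. Then there is `θ : ℕ → ℝ` such that the unimodular completely
multiplicative twist `a = complMul (p ↦ e^{iθ(p)})` gives the twisted model
`Z_a(s) = Σ'_v a(Q(v)) Q(v)^{-s}` of `Q = (A, t − 2k, C)` a real zero `s₁ > 1` and a real
non-zero `s₂ > 1`. [cite: DavenportHeilbronn1936b, §5 Lemma 2] -/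
theorem exists_real_zero_twistModel_of_odd (h2 : finrank ℚ K = 2)
    (b : Basis (Fin 2) ℤ (𝓞 K)) (hb : b 0 = 1)
    {t m : ℤ} (hω : b 1 * b 1 = (m : 𝓞 K) + (t : 𝓞 K) * b 1) (hD : t ^ 2 + 4 * m < -4)
    {A k C : ℤ} (hA : 0 < A) (hn : A * C = k ^ 2 - t * k - m)
    (hodd : Odd (Nat.card (ClassGroup (𝓞 K)))) (hh : 1 < Nat.card (ClassGroup (𝓞 K))) :
    ∃ θ : ℕ → ℝ,
      (∃ s₁ : ℝ, 1 < s₁ ∧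
        twistModel ((complMul fun p ↦ cexp (θ p * I)).toMonoidHom) A (t - 2 * k) C (s₁ : ℂ) = 0) ∧
      ∃ s₂ : ℝ, 1 < s₂ ∧
        twistModel ((complMul fun p ↦ cexp (θ p * I)).toMonoidHom) A (t - 2 * k) C (s₂ : ℂ) ≠ 0 := by
  -- ### notation
  haveI : Nonempty (HeightOneSpectrum (𝓞 K)) := by
    obtain ⟨M, hM⟩ := Ideal.exists_maximal (𝓞 K)
    exact ⟨⟨M, hM.isPrime, Ring.ne_bot_of_isMaximal_of_not_isField hM (RingOfIntegers.not_isField K)⟩⟩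
  set hK : ℕ := Nat.card (ClassGroup (𝓞 K))
  have hh3 : 3 ≤ hK := by obtain ⟨j, hj⟩ := hodd; omega
  have hhR : (3 : ℝ) ≤ hK := by exact_mod_cast hh3
  have hh0 : (0 : ℝ) < hK := by linarith
  set kcl : ClassGroup (𝓞 K) := idealClass (Ideal.span {(A : 𝓞 K), b 1 - k}) with hkcl
  set cls : AddChar (Additive (ClassGroup (𝓞 K))) ℂ → ℝ := fun χ ↦ (toMulHom χ kcl).re with hcls
  set ℓf : ℂ → ℝ → ℝ → ℂ := fun c x φ ↦ -Complex.log (1 - c * x * cexp (φ * I)) with hℓf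
  have hℓf_eq : ∀ (c : ℂ) (x φ : ℝ), ℓf c x φ = -Complex.log (1 - c * x * cexp (φ * I)) := fun _ _ _ ↦ rfl
  -- ### Step 0: the characters `χ*`, the class `g₀`
  obtain ⟨χs, hχs0, hrcs⟩ := exists_addChar_re_ne_zero hh kcl
  obtain ⟨g₀, hc₀⟩ := exists_re_toMulHom_neg hχs0
  have hg₀1 : g₀ ≠ 1 := fun h ↦ by rw [h, map_one, Complex.one_re] at hc₀; linarith
  obtain ⟨hχsneg, hnegχs0⟩ := ne_neg_of_ne_zero_of_odd hodd hχs0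
  set us : ℂ := toMulHom χs g₀ with hus_def
  have hus : ‖us‖ = 1 := norm_toMulHom χs g₀
  have husre : us.re ≤ 0 := hc₀.le
  have hrcs' : cls χs ≠ 0 := hrcs
  -- ### Step 1: the phase prime `p₁`
  obtain ⟨F₁, hF₁, hμ₁, -⟩ := exists_finset_splitPrimes h2 hodd hg₀1 (Y := 40) (by norm_num)
    (μ := 1 / 80) (by norm_num)
  have hF₁ne : F₁.Nonempty := by
    by_contra hF
    rw [Finset.not_nonempty_iff_eq_empty] at hF
    rw [hF, Finset.sum_empty] at hμ₁
    linarith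
  obtain ⟨p₁, hp₁F⟩ := hF₁ne
  obtain ⟨hp₁40, hp₁, V₁, W₁, hVW₁, hV₁, hW₁, hV₁cls⟩ := hF₁ p₁ hp₁F
  have hp₁4 : 4 ≤ p₁ := by omega
  have hp₁R : (41 : ℝ) ≤ p₁ := by exact_mod_cast (show 41 ≤ p₁ by omega)
  have hp₁pos : (0 : ℝ) < p₁ := by linarith
  set xs : ℝ → ℝ := fun s ↦ (p₁ : ℝ) ^ (-s) with hxs_def
  set x₁ : ℝ := xs 1 with hx₁_def
  have hx₁ : x₁ = 1 / p₁ := by simp only [hx₁_def, hxs_def, Real.rpow_neg_one, one_div]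
  have hx₁pos : 0 < x₁ := by rw [hx₁]; positivity
  have hx₁le : x₁ ≤ 1 / 41 := by rw [hx₁]; exact one_div_le_one_div_of_le (by norm_num) hp₁R
  have hxs_pos : ∀ s, 0 < xs s := fun s ↦ Real.rpow_pos_of_pos hp₁pos _
  have hxs_le : ∀ s, 1 ≤ s → xs s ≤ x₁ := fun s hs ↦
    Real.rpow_le_rpow_of_exponent_le (by linarith) (by linarith)
  have hxs_cont : Continuous xs := (Real.continuous_const_rpow hp₁pos.ne').comp continuous_neg
  -- ### Step 2: the base twist `a(p) = i` and its limits
  set a₀f : ℕ → ℂ := ⇑(complMul fun _ : ℕ ↦ cexp ((Real.pi / 2 : ℝ) * I)) with ha₀f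
  have ha₀f1 : ∀ n, ‖a₀f n‖ ≤ 1 := norm_complMul_cexp_le _
  set E0 : AddChar (Additive (ClassGroup (𝓞 K))) ℂ → ℝ → ℂ := fun χ s ↦ logEuler (twistCoeff χ a₀f) s with hE0
  have hE0cont : ∀ χ, ContinuousOn (E0 χ) (Ioi 1) := fun χ ↦ continuousOn_logEuler (norm_twistCoeff_le χ ha₀f1)
  have hLim0 : ∀ χ : AddChar (Additive (ClassGroup (𝓞 K))) ℂ, χ ≠ 0 →
      ∃ ℓ : ℂ, Tendsto (E0 χ) (𝓝[>] 1) (𝓝 ℓ) := fun χ hχ ↦ tendsto_logEuler_base χ hχ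
  choose! Lim hLim using hLim0
  obtain ⟨r₀, L₀, hr₀, -⟩ := base_zero_limits (K := K)
  set Dr : ℝ → ℝ := fun s ↦ ∑' v : HeightOneSpectrum (𝓞 K),
    (if (Ideal.absNorm v.asIdeal).Prime then npow v s else 0 : ℝ) with hDr
  have hDC : ∀ s : ℝ, ∑' v, primeTerm (charCoeff ⊤ (primeClass (K := K)) 0) s v = (Dr s : ℂ) :=
    fun s ↦ tsum_primeTerm_zero_eq_ofReal s
  have hRst : Tendsto (fun s ↦ E0 0 s - I * (Dr s : ℂ)) (𝓝[>] 1) (𝓝 r₀) := by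
    refine hr₀.congr' ?_
    filter_upwards with s
    rw [hDC]
  have hDr_top : Tendsto Dr (𝓝[>] 1) atTop := tendsto_primeSumReal_atTop
  have hDr_cont : ContinuousOn Dr (Ioi 1) := continuousOn_primeSumReal
  -- ### Step 3: design constants
  set sG : Finset (ClassGroup (𝓞 K)) := Finset.univ.erase 1 with hsG
  set Lsum : ℝ := ∑ χ ∈ Finset.univ.erase (0 : AddChar (Additive (ClassGroup (𝓞 K))) ℂ), ‖Lim χ‖ with hLsum
  have hLsum0 : 0 ≤ Lsum := Finset.sum_nonneg fun χ _ ↦ norm_nonneg _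
  have hLim_le : ∀ χ, χ ≠ 0 → ‖Lim χ‖ ≤ Lsum := fun χ hχ ↦
    Finset.single_le_sum (f := fun χ ↦ ‖Lim χ‖) (fun χ _ ↦ norm_nonneg _) (Finset.mem_erase.2 ⟨hχ, Finset.mem_univ χ⟩)
  -- the `φ`-constant terms and the phase gap at the endpoints, as functions of `x`
  set lamR : ℝ → ℝ → ℝ := fun x φ ↦ 2 * (ℓf 1 x φ).re - (ℓf us x φ).re - (ℓf us⁻¹ x φ).re with hlamR
  set cΛ : ℝ → ℝ := fun x ↦ (2 * ℓf 1 x (Real.pi / 2) - ℓf us x (Real.pi / 2) - ℓf us⁻¹ x (Real.pi / 2)).re with hcΛ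
  set μf : ℝ → ℝ := fun x ↦ (lamR x (Real.pi / 6) + lamR x (5 * Real.pi / 6)) / 2 with hμf
  set Pb : ℝ := r₀.re - (Lim χs).re - Real.log (2 * |cls χs|) - cΛ x₁ + μf x₁ with hPb
  set T₀ : ℝ := (2 * Lsum + 2 + Real.log (800 * hK * p₁ / |cls χs|)) / hK with hT₀
  set T₁ : ℝ := (T₀ * hK - Pb) / (2 * hK) with hT₁
  set tg : ClassGroup (𝓞 K) → ℝ := fun g ↦ T₀ * (toMulHom χs g).re + T₁ with htg
  set mg : ClassGroup (𝓞 K) → ℝ := fun g ↦ |tg g| with hmg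
  set βg : ClassGroup (𝓞 K) → ℝ := fun g ↦ if 0 ≤ tg g then 0 else Real.pi with hβg
  have hβg01 : ∀ g, βg g = 0 ∨ βg g = Real.pi := fun g ↦ by
    simp only [hβg]; split_ifs <;> simp
  have hcosm : ∀ g, Real.cos (βg g) * mg g = tg g := fun g ↦ by
    simp only [hβg, hmg]
    split_ifs with h
    · rw [Real.cos_zero, one_mul, abs_of_nonneg h]
    · rw [Real.cos_pi, abs_of_neg (not_le.1 h)]; ring
  set ERR : ℝ := ∑ g ∈ sG, (6 + 4 * mg g) with hERR
  have hERR0 : 0 ≤ ERR := Finset.sum_nonneg fun g _ ↦ by have := abs_nonneg (tg g); simp only [hmg]; linarith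
  obtain ⟨Y, hY⟩ := exists_nat_gt (max ((p₁ : ℝ) + 1) (64 * ERR * p₁))
  have hYp₁ : p₁ < Y := by
    have : (p₁ : ℝ) + 1 < Y := lt_of_le_of_lt (le_max_left _ _) hY
    exact_mod_cast (by linarith : (p₁ : ℝ) < Y)
  have hY1 : 1 ≤ Y := by omega
  have hY4 : ∀ p, Y < p → 4 ≤ p := fun p hp ↦ by omega
  have hYR : (0 : ℝ) < Y := by exact_mod_cast (show 0 < Y by omega)
  have hERRY : ERR / Y ≤ x₁ / 64 := by
    have h1 : 64 * ERR * p₁ < Y := lt_of_le_of_lt (le_max_right _ _) hY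
    rw [hx₁, div_le_div_iff₀ hYR (by norm_num), show 1 / (p₁ : ℝ) * Y = Y / p₁ by ring,
      le_div_iff₀ hp₁pos]
    linarith
  -- ### Step 4: the boost family of split primes
  obtain ⟨S, hS, hSdisj⟩ := exists_family_splitPrimes h2 hodd sG (fun g ↦ g) mg
    (fun g hg ↦ Finset.ne_of_mem_erase hg) (fun g _ ↦ abs_nonneg _) hY1
  have hsel : ∀ g ∈ sG, ∀ p ∈ S g, ∃ v : HeightOneSpectrum (𝓞 K),
      (p.Prime ∧ Ideal.absNorm v.asIdeal = p ∧ ∃ w : HeightOneSpectrum (𝓞 K), w ≠ v ∧ Ideal.absNorm w.asIdeal = p) ∧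
        primeClass v = g ∧ Y < p := by
    intro g hg p hp
    obtain ⟨hYp, hpP, v, w, hvw, hv, hw, hcls'⟩ := (hS g hg).1 p hp
    exact ⟨v, ⟨hpP, hv, w, hvw.symm, hw⟩, hcls', hYp⟩
  choose! Vsel hVsel using hsel
  -- the label of a boost prime and the boost set
  set SB : Finset ℕ := sG.biUnion S with hSB
  have hlab_ex : ∀ p ∈ SB, ∃! g, g ∈ sG ∧ p ∈ S g := by
    intro p hp
    obtain ⟨g, hg, hpg⟩ := Finset.mem_biUnion.1 hp
    refine ⟨g, ⟨hg, hpg⟩, fun g' ⟨hg', hpg'⟩ ↦ ?_⟩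
    by_contra hne
    exact Finset.disjoint_left.1 (hSdisj g' hg' g hg hne) hpg' hpg
  set lab : ℕ → ClassGroup (𝓞 K) := fun p ↦ if hp : p ∈ SB then (hlab_ex p hp).choose else 1 with hlab
  have hlab_spec : ∀ g ∈ sG, ∀ p ∈ S g, lab p = g := by
    intro g hg p hpg
    have hp : p ∈ SB := Finset.mem_biUnion.2 ⟨g, hg, hpg⟩
    have h1 := (hlab_ex p hp).choose_spec
    have huniq := h1.2 g ⟨hg, hpg⟩
    simp only [hlab, dif_pos hp]
    exact huniq.symm
  have hlab_mem : ∀ p ∈ SB, lab p ∈ sG ∧ p ∈ S (lab p) := by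
    intro p hp
    have h1 := (hlab_ex p hp).choose_spec.1
    simp only [hlab, dif_pos hp]
    exact h1
  have hSBY : ∀ p ∈ SB, Y < p := fun p hp ↦ (hVsel (lab p) (hlab_mem p hp).1 p (hlab_mem p hp).2).2.2
  have hp₁SB : p₁ ∉ SB := fun h ↦ lt_irrefl _ ((hSBY p₁ h).trans hYp₁)
  -- ### the twist family and the prime data
  set θf : ℝ → ℕ → ℝ := fun φ p ↦ if p = p₁ then φ else if p ∈ SB then βg (lab p) else Real.pi / 2 with hθf
  set V : ℕ → HeightOneSpectrum (𝓞 K) := fun p ↦ if p = p₁ then V₁ else Vsel (lab p) p with hV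
  set F : Finset ℕ := insert p₁ SB with hF
  have hFdata : ∀ p ∈ F, p.Prime ∧ Ideal.absNorm (V p).asIdeal = p ∧
      ∃ w : HeightOneSpectrum (𝓞 K), w ≠ V p ∧ Ideal.absNorm w.asIdeal = p := by
    intro p hp
    rcases Finset.mem_insert.1 hp with rfl | hp
    · simp only [hV, if_true]
      exact ⟨hp₁, hV₁, W₁, hVW₁.symm, hW₁⟩
    · have hne : p ≠ p₁ := fun h ↦ hp₁SB (h ▸ hp)
      simp only [hV, if_neg hne]
      exact (hVsel (lab p) (hlab_mem p hp).1 p (hlab_mem p hp).2).1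
  have hθf_out : ∀ φ : ℝ, ∀ p : ℕ, p.Prime → p ∉ F → θf φ p = Real.pi / 2 := by
    intro φ p _ hp
    have h1 : p ≠ p₁ := fun h ↦ hp (h ▸ Finset.mem_insert_self p₁ SB)
    have h2 : p ∉ SB := fun h ↦ hp (Finset.mem_insert_of_mem h)
    simp only [hθf, if_neg h1, if_neg h2]
  have hθf_p₁ : ∀ φ, θf φ p₁ = φ := fun φ ↦ by simp only [hθf, if_true]
  have hθf_SB : ∀ φ, ∀ p ∈ SB, θf φ p = βg (lab p) := fun φ p hp ↦ by
    have hne : p ≠ p₁ := fun h ↦ hp₁SB (h ▸ hp)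
    simp only [hθf, if_neg hne, if_pos hp]
  have hV_p₁ : V p₁ = V₁ := by simp only [hV, if_true]
  have hV_SB : ∀ p ∈ SB, V p = Vsel (lab p) p := fun p hp ↦ by
    have hne : p ≠ p₁ := fun h ↦ hp₁SB (h ▸ hp)
    simp only [hV, if_neg hne]
  have hVcls_SB : ∀ p ∈ SB, primeClass (V p) = lab p := fun p hp ↦ by
    rw [hV_SB p hp]; exact (hVsel (lab p) (hlab_mem p hp).1 p (hlab_mem p hp).2).2.1
  -- the characters' values at the relevant classes
  set uχ : AddChar (Additive (ClassGroup (𝓞 K))) ℂ → ℂ := fun χ ↦ toMulHom χ g₀ with huχ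
  have huχ1 : ∀ χ, ‖uχ χ‖ = 1 := fun χ ↦ norm_toMulHom χ g₀
  -- ### Step 5: the factorisation of `E_χ` along the family
  -- the local term at a boost prime and at the phase prime
  set Λp : AddChar (Additive (ClassGroup (𝓞 K))) ℂ → ℕ → ℝ → ℝ → ℂ := fun χ p ψ s ↦
    ℓf (toMulHom χ (primeClass (V p))) ((p : ℝ) ^ (-s)) ψ + ℓf (toMulHom χ (primeClass (V p)))⁻¹ ((p : ℝ) ^ (-s)) ψ -
      ℓf (toMulHom χ (primeClass (V p))) ((p : ℝ) ^ (-s)) (Real.pi / 2) -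
      ℓf (toMulHom χ (primeClass (V p)))⁻¹ ((p : ℝ) ^ (-s)) (Real.pi / 2) with hΛp
  set Bχ : AddChar (Additive (ClassGroup (𝓞 K))) ℂ → ℝ → ℂ := fun χ s ↦ ∑ p ∈ SB, Λp χ p (βg (lab p)) s with hBχ
  set Λ₁ : AddChar (Additive (ClassGroup (𝓞 K))) ℂ → ℝ → ℝ → ℂ := fun χ φ s ↦
    ℓf (uχ χ) (xs s) φ + ℓf (uχ χ)⁻¹ (xs s) φ - ℓf (uχ χ) (xs s) (Real.pi / 2) - ℓf (uχ χ)⁻¹ (xs s) (Real.pi / 2) with hΛ₁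
  have hfact : ∀ (φ : ℝ) (χ : AddChar (Additive (ClassGroup (𝓞 K))) ℂ) (s : ℝ), 1 < s →
      logEuler (twistCoeff χ (complMul fun p ↦ cexp (θf φ p * I))) s = E0 χ s + Λ₁ χ φ s + Bχ χ s := by
    intro φ χ s hs
    have h := logEuler_twistCoeff_complMul_eq h2 χ (θf φ) F V hFdata (hθf_out φ) hs
    rw [h, hF, Finset.sum_insert hp₁SB, hθf_p₁, hV_p₁, hV₁cls]
    simp only [hE0, hΛ₁, hBχ, hΛp, huχ, hℓf, hxs_def]
    rw [add_assoc]
    congr 1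
    congr 1
    exact Finset.sum_congr rfl fun p hp ↦ by rw [hθf_SB φ p hp]
  -- ### Step 6: the real parts of the boosts at `s = 1`
  set RB : AddChar (Additive (ClassGroup (𝓞 K))) ℂ → ℝ → ℝ := fun χ s ↦ (Bχ χ s).re with hRB
  set Main : AddChar (Additive (ClassGroup (𝓞 K))) ℂ → ℝ := fun χ ↦ ∑ g ∈ sG, 2 * (toMulHom χ g).re * tg g with hMain
  have hRB1 : ∀ χ, |RB χ 1 - Main χ| ≤ x₁ / 64 := by
    intro χ
    have hdisjS : (sG : Set (ClassGroup (𝓞 K))).PairwiseDisjoint S := fun g hg g' hg' hne ↦ hSdisj g hg g' hg' hne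
    have hsum : RB χ 1 = ∑ g ∈ sG, ∑ p ∈ S g, (Λp χ p (βg (lab p)) 1).re := by
      simp only [hRB, hBχ, Complex.re_sum, hSB]
      rw [Finset.sum_biUnion hdisjS]
    -- per class
    have hblock : ∀ g ∈ sG, |∑ p ∈ S g, (Λp χ p (βg (lab p)) 1).re - 2 * (toMulHom χ g).re * tg g| ≤
        (6 + 4 * mg g) / Y := by
      intro g hg
      have hSg := (hS g hg)
      have h := boost_block_estimate (u := toMulHom χ g) (norm_toMulHom χ g) (hβg01 g) hY1 (S g)
        (fun p hp ↦ (hSg.1 p hp).1) (hcosm g) ⟨hSg.2.1, hSg.2.2⟩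
      refine le_trans (le_of_eq ?_) h
      congr 1
      congr 1
      refine Finset.sum_congr rfl fun p hp ↦ ?_
      have hpSB : p ∈ SB := Finset.mem_biUnion.2 ⟨g, hg, hp⟩
      have hlp : lab p = g := hlab_spec g hg p hp
      have hx : ((p : ℝ) ^ (-(1 : ℝ))) = 1 / p := by rw [Real.rpow_neg_one, one_div]
      simp only [hΛp, hℓf, hVcls_SB p hpSB, hlp, hx]
    calc |RB χ 1 - Main χ| = |∑ g ∈ sG, (∑ p ∈ S g, (Λp χ p (βg (lab p)) 1).re - 2 * (toMulHom χ g).re * tg g)| := by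
          rw [hsum, hMain, Finset.sum_sub_distrib]
      _ ≤ ∑ g ∈ sG, |∑ p ∈ S g, (Λp χ p (βg (lab p)) 1).re - 2 * (toMulHom χ g).re * tg g| :=
          Finset.abs_sum_le_sum_abs _ _
      _ ≤ ∑ g ∈ sG, (6 + 4 * mg g) / Y := Finset.sum_le_sum hblock
      _ = ERR / Y := by rw [hERR, Finset.sum_div]
      _ ≤ x₁ / 64 := hERRY
  -- the main terms by orthogonality
  have hMain_eq : ∀ χ, Main χ = 2 * T₀ * ((hK : ℝ) / 2 * ((if χ = χs then 1 else 0) + (if χ = -χs then 1 else 0)) - 1) +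
      2 * T₁ * ((hK : ℝ) * (if χ = 0 then 1 else 0) - 1) := by
    intro χ
    have h1 : ∑ g ∈ sG, (toMulHom χ g).re * (toMulHom χs g).re =
        (hK : ℝ) / 2 * ((if χ = χs then 1 else 0) + (if χ = -χs then 1 else 0)) - 1 := by
      rw [hsG, Finset.sum_erase_eq_sub (Finset.mem_univ _), sum_re_toMulHom_mul_re, map_one, map_one,
        Complex.one_re, mul_one]
    have h2' : ∑ g ∈ sG, (toMulHom χ g).re = (hK : ℝ) * (if χ = 0 then 1 else 0) - 1 := by
      rw [hsG, Finset.sum_erase_eq_sub (Finset.mem_univ _), sum_re_toMulHom, map_one, Complex.one_re]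
    simp only [hMain, htg]
    have e : ∀ g, 2 * (toMulHom χ g).re * (T₀ * (toMulHom χs g).re + T₁) =
        2 * T₀ * ((toMulHom χ g).re * (toMulHom χs g).re) + 2 * T₁ * (toMulHom χ g).re := fun g ↦ by ring
    simp only [e, Finset.sum_add_distrib, ← Finset.mul_sum, h1, h2']
  have hMain0 : Main 0 = -2 * T₀ + 2 * T₁ * (hK - 1) := by
    rw [hMain_eq, if_neg hχs0.symm, if_neg (Ne.symm hnegχs0), if_pos rfl]; ring
  have hMains : Main χs = T₀ * hK - 2 * T₀ - 2 * T₁ := by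
    rw [hMain_eq, if_pos rfl, if_neg hχsneg, if_neg hχs0]; ring
  have hMainO : ∀ χ, χ ≠ 0 → χ ≠ χs → χ ≠ -χs → Main χ = -2 * T₀ - 2 * T₁ := by
    intro χ h0 h1 h2'
    rw [hMain_eq, if_neg h1, if_neg h2', if_neg h0]; ring
  have hT₁eq : 2 * T₁ * hK = T₀ * hK - Pb := by
    simp only [hT₁]; field_simp
  have hT₀eq : T₀ * hK = 2 * Lsum + 2 + Real.log (800 * hK * p₁ / |cls χs|) := by
    simp only [hT₀]; field_simp
  -- ### Step 7: continuity of the finite sums, and the interval `(1, s₁]`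
  have hus' : ‖us⁻¹‖ = 1 := by rw [norm_inv, hus, inv_one]
  have hΛp_cont : ∀ χ, ∀ p ∈ SB, ∀ ψ : ℝ, ContinuousOn (fun s ↦ Λp χ p ψ s) (Ioi (1 / 2)) := by
    intro χ p hp ψ
    have h4 : 4 ≤ p := hY4 p (hSBY p hp)
    have hc1 : ‖toMulHom χ (primeClass (V p))‖ = 1 := norm_toMulHom _ _
    have hc2 : ‖(toMulHom χ (primeClass (V p)))⁻¹‖ = 1 := by rw [norm_inv, hc1, inv_one]
    simp only [hΛp, hℓf]
    exact (((continuousOn_locLog_rpow hc1 h4 ψ).add (continuousOn_locLog_rpow hc2 h4 ψ)).sub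
      (continuousOn_locLog_rpow hc1 h4 _)).sub (continuousOn_locLog_rpow hc2 h4 _)
  have hBχ_cont : ∀ χ, ContinuousOn (Bχ χ) (Ioi (1 / 2)) := fun χ ↦ by
    simp only [hBχ]
    exact continuousOn_finsetSum _ fun p hp ↦ hΛp_cont χ p hp _
  have hℓ1_cont : ∀ {c : ℂ}, ‖c‖ = 1 → ∀ ψ : ℝ, ContinuousOn (fun s ↦ ℓf c (xs s) ψ) (Ioi (1 / 2)) :=
    fun {c} hc ψ ↦ by simp only [hℓf, hxs_def]; exact continuousOn_locLog_rpow hc hp₁4 ψ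
  set cΛs : ℝ → ℂ := fun s ↦ 2 * ℓf 1 (xs s) (Real.pi / 2) - ℓf us (xs s) (Real.pi / 2) -
    ℓf us⁻¹ (xs s) (Real.pi / 2) with hcΛs
  have hcΛs_re : ∀ s, (cΛs s).re = cΛ (xs s) := fun s ↦ rfl
  set μs : ℝ → ℝ := fun s ↦ μf (xs s) with hμs
  have hcΛs_cont : ContinuousOn cΛs (Ioi (1 / 2)) :=
    ((continuousOn_const.mul (hℓ1_cont norm_one _)).sub (hℓ1_cont hus _)).sub (hℓ1_cont hus' _)
  have hlamR_cont : ∀ ψ, ContinuousOn (fun s ↦ lamR (xs s) ψ) (Ioi (1 / 2)) := fun ψ ↦ by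
    simp only [hlamR]
    exact ((continuousOn_const.mul (Complex.continuous_re.comp_continuousOn (hℓ1_cont norm_one ψ))).sub
      (Complex.continuous_re.comp_continuousOn (hℓ1_cont hus ψ))).sub
      (Complex.continuous_re.comp_continuousOn (hℓ1_cont hus' ψ))
  have hμs_cont : ContinuousOn μs (Ioi (1 / 2)) := by
    simp only [hμs, hμf]
    exact ((hlamR_cont _).add (hlamR_cont _)).div_const 2
  have hIoi_mem : Ioi (1 / 2 : ℝ) ∈ 𝓝 (1 : ℝ) := Ioi_mem_nhds (by norm_num)
  have htend : ∀ {f : ℝ → ℂ}, ContinuousOn f (Ioi (1 / 2)) → Tendsto f (𝓝[>] 1) (𝓝 (f 1)) :=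
    fun {f} hf ↦ ((hf.continuousAt hIoi_mem).tendsto).mono_left nhdsWithin_le_nhds
  have htendR : ∀ {f : ℝ → ℝ}, ContinuousOn f (Ioi (1 / 2)) → Tendsto f (𝓝[>] 1) (𝓝 (f 1)) :=
    fun {f} hf ↦ ((hf.continuousAt hIoi_mem).tendsto).mono_left nhdsWithin_le_nhds
  set ε : ℝ := x₁ / 200 with hε
  have hε0 : 0 < ε := by positivity
  have hev : ∀ᶠ s in 𝓝[>] (1 : ℝ),
      dist (E0 0 s - I * (Dr s : ℂ)) r₀ < ε ∧
      ((∀ χ ∈ Finset.univ.erase (0 : AddChar (Additive (ClassGroup (𝓞 K))) ℂ), dist (E0 χ s) (Lim χ) < ε) ∧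
      ((∀ χ ∈ (Finset.univ : Finset (AddChar (Additive (ClassGroup (𝓞 K))) ℂ)), dist (Bχ χ s) (Bχ χ 1) < ε) ∧
      (dist (cΛs s) (cΛs 1) < ε ∧ (dist (μs s) (μs 1) < ε ∧ (dist (xs s) (xs 1) < x₁ / 2 ∧ s ∈ Ioo (1 : ℝ) 2))))) := by
    refine (Metric.tendsto_nhds.1 hRst ε hε0).and ?_
    refine ((Filter.eventually_all_finset _).2 fun χ hχ ↦
      Metric.tendsto_nhds.1 (hLim χ (Finset.ne_of_mem_erase hχ)) ε hε0).and ?_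
    refine ((Filter.eventually_all_finset _).2 fun χ _ ↦ Metric.tendsto_nhds.1 (htend (hBχ_cont χ)) ε hε0).and ?_
    refine (Metric.tendsto_nhds.1 (htend hcΛs_cont) ε hε0).and ?_
    refine (Metric.tendsto_nhds.1 (htendR hμs_cont) ε hε0).and ?_
    exact (Metric.tendsto_nhds.1 (htendR hxs_cont.continuousOn) (x₁ / 2) (by positivity)).and
      (Ioo_mem_nhdsGT (by norm_num))
  obtain ⟨s₁, hs₁, hsub⟩ := mem_nhdsGT_iff_exists_Ioc_subset.1 hev
  rw [mem_Ioi] at hs₁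
  have hS1 : ∀ s ∈ Ioc 1 s₁, ‖E0 0 s - I * (Dr s : ℂ) - r₀‖ < ε ∧
      (∀ χ, χ ≠ 0 → ‖E0 χ s - Lim χ‖ < ε) ∧ (∀ χ, ‖Bχ χ s - Bχ χ 1‖ < ε) ∧
      ‖cΛs s - cΛs 1‖ < ε ∧ |μs s - μs 1| < ε ∧ x₁ / 2 < xs s ∧ 1 < s ∧ s ≤ 2 := by
    intro s hs
    obtain ⟨h1, h2', h3, h4, h5, h6, h7⟩ := hsub hs
    refine ⟨by rwa [← dist_eq_norm], fun χ hχ ↦ ?_, fun χ ↦ ?_, by rwa [← dist_eq_norm],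
      by rwa [← Real.dist_eq], ?_, h7.1, h7.2.le⟩
    · rw [← dist_eq_norm]; exact h2' χ (Finset.mem_erase.2 ⟨hχ, Finset.mem_univ χ⟩)
    · rw [← dist_eq_norm]; exact h3 χ (Finset.mem_univ χ)
    · have := h6; rw [Real.dist_eq] at this
      have := (abs_lt.1 this).1
      change x₁ / 2 < xs s
      have hx1 : xs 1 = x₁ := rfl
      linarith
  -- ### the normalising data
  set c2 : ℝ := 2 * cls χs with hc2
  have hc2ne : c2 ≠ 0 := mul_ne_zero two_ne_zero hrcs'
  have hc2C : ((c2 : ℝ) : ℂ) ≠ 0 := by exact_mod_cast hc2ne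
  have hc2abs : |c2| = 2 * |cls χs| := by rw [hc2, abs_mul, abs_two]
  set κ : ℂ := Complex.log (c2 : ℂ) with hκ
  have hexpκ : cexp κ = (c2 : ℂ) := Complex.exp_log (by exact_mod_cast hc2ne)
  have hκre : κ.re = Real.log (2 * |cls χs|) := by
    rw [hκ, Complex.log_re, Complex.norm_real, Real.norm_eq_abs, hc2abs]
  set q : ℝ → ℂ := fun s ↦ (E0 0 s - I * (Dr s : ℂ)) + Bχ 0 s - E0 χs s - Bχ χs s - κ - cΛs s with hq
  set O : Finset (AddChar (Additive (ClassGroup (𝓞 K))) ℂ) := ((Finset.univ.erase 0).erase χs).erase (-χs) with hO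
  have hOmem : ∀ χ ∈ O, χ ≠ 0 ∧ χ ≠ χs ∧ χ ≠ -χs := fun χ hχ ↦
    ⟨Finset.ne_of_mem_erase (Finset.mem_of_mem_erase (Finset.mem_of_mem_erase hχ)),
      Finset.ne_of_mem_erase (Finset.mem_of_mem_erase hχ), Finset.ne_of_mem_erase hχ⟩
  have hOcard : (O.card : ℝ) ≤ hK := by
    have h1 : O.card ≤ Fintype.card (AddChar (Additive (ClassGroup (𝓞 K))) ℂ) := Finset.card_le_univ O
    rw [AddChar.card_eq, Fintype.card_congr Additive.ofMul.symm, Fintype.card_eq_nat_card] at h1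
    exact_mod_cast h1
  set cπ : AddChar (Additive (ClassGroup (𝓞 K))) ℂ → ℝ → ℂ := fun χ s ↦
    ℓf (uχ χ) (xs s) (Real.pi / 2) + ℓf (uχ χ)⁻¹ (xs s) (Real.pi / 2) - ℓf us (xs s) (Real.pi / 2) -
      ℓf us⁻¹ (xs s) (Real.pi / 2) with hcπ
  set kf : AddChar (Additive (ClassGroup (𝓞 K))) ℂ → ℝ → ℂ := fun χ s ↦
    ((cls χ / c2 : ℝ) : ℂ) * cexp (E0 χ s + Bχ χ s - E0 χs s - Bχ χs s - cπ χ s) with hkf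
  have huχ' : ∀ χ, ‖(uχ χ)⁻¹‖ = 1 := fun χ ↦ by rw [norm_inv, huχ1 χ, inv_one]
  have hSsub : Ioc 1 s₁ ⊆ Ioi (1 : ℝ) := fun s hs ↦ hs.1
  have hSsub' : Ioc 1 s₁ ⊆ Ioi (1 / 2 : ℝ) := fun s hs ↦ by have := hs.1; rw [mem_Ioi]; linarith
  -- ### the hypotheses of the abstract zero theorem
  have hD' : ContinuousOn Dr (Ioc 1 s₁) := hDr_cont.mono hSsub
  have hq' : ContinuousOn q (Ioc 1 s₁) := by
    simp only [hq]
    refine (((((((hE0cont 0).mono hSsub).sub (continuousOn_const.mul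
      (Complex.continuous_ofReal.comp_continuousOn hD'))).add ((hBχ_cont 0).mono hSsub')).sub
      ((hE0cont χs).mono hSsub)).sub ((hBχ_cont χs).mono hSsub')).sub continuousOn_const).sub
      (hcΛs_cont.mono hSsub')
  set Mq : ℝ := ‖r₀‖ + ‖Bχ 0 1‖ + ‖Lim χs‖ + ‖Bχ χs 1‖ + ‖κ‖ + ‖cΛs 1‖ + 6 with hMq
  have hqb' : ∀ s ∈ Ioc 1 s₁, ‖q s‖ ≤ Mq := by
    intro s hs
    obtain ⟨h1, h2', h3, h4, -, -, -, -⟩ := hS1 s hs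
    have e1 : ‖E0 0 s - I * (Dr s : ℂ)‖ ≤ ‖r₀‖ + ε := by
      have := norm_sub_norm_le (E0 0 s - I * (Dr s : ℂ)) r₀; linarith
    have e2 : ‖Bχ 0 s‖ ≤ ‖Bχ 0 1‖ + ε := by have := norm_sub_norm_le (Bχ 0 s) (Bχ 0 1); linarith [h3 0]
    have e3 : ‖E0 χs s‖ ≤ ‖Lim χs‖ + ε := by have := norm_sub_norm_le (E0 χs s) (Lim χs); linarith [h2' χs hχs0]
    have e4 : ‖Bχ χs s‖ ≤ ‖Bχ χs 1‖ + ε := by have := norm_sub_norm_le (Bχ χs s) (Bχ χs 1); linarith [h3 χs]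
    have e5 : ‖cΛs s‖ ≤ ‖cΛs 1‖ + ε := by have := norm_sub_norm_le (cΛs s) (cΛs 1); linarith
    have hε1 : ε ≤ 1 := by rw [hε]; linarith
    have := norm_add_sub_sub_sub_sub_le (E0 0 s - I * (Dr s : ℂ)) (Bχ 0 s) (E0 χs s) (Bχ χs s) κ (cΛs s)
    simp only [hq, hMq]
    linarith
  have hxs' : ContinuousOn xs (Ioc 1 s₁) := hxs_cont.continuousOn
  have hx' : ∀ s ∈ Ioc 1 s₁, 0 < xs s ∧ xs s ≤ 1 / 40 := fun s hs ↦
    ⟨hxs_pos s, (hxs_le s hs.1.le).trans (hx₁le.trans (by norm_num))⟩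
  have hk' : ∀ χ ∈ O, ContinuousOn (kf χ) (Ioc 1 s₁) := by
    intro χ _
    simp only [hkf, hcπ]
    refine continuousOn_const.mul (ContinuousOn.cexp ?_)
    refine ((((hE0cont χ).mono hSsub).add ((hBχ_cont χ).mono hSsub')).sub ((hE0cont χs).mono hSsub)).sub
      ((hBχ_cont χs).mono hSsub') |>.sub ?_
    exact ((((hℓ1_cont (huχ1 χ) _).add (hℓ1_cont (huχ' χ) _)).sub (hℓ1_cont hus _)).sub
      (hℓ1_cont hus' _)).mono hSsub'
  have hcpos : 0 < |cls χs| := abs_pos.2 hrcs'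
  have hsmall' : ∀ s ∈ Ioc 1 s₁, ∑ χ ∈ O, ‖kf χ s‖ ≤ xs s / 200 := by
    intro s hs
    obtain ⟨-, h2', h3, -, -, h6, h7, -⟩ := hS1 s hs
    have hxs1 : xs s ≤ x₁ := hxs_le s h7.le
    have hterm : ∀ χ ∈ O, ‖kf χ s‖ ≤ 1 / (1600 * hK * p₁) := by
      intro χ hχ
      obtain ⟨h0, h1, h2''⟩ := hOmem χ hχ
      -- the coefficient
      have hcoef : ‖((cls χ / c2 : ℝ) : ℂ)‖ ≤ 1 / (2 * |cls χs|) := by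
        rw [Complex.norm_real, Real.norm_eq_abs, abs_div, hc2abs]
        have : |cls χ| ≤ 1 := by
          have := Complex.abs_re_le_norm (toMulHom χ kcl); rwa [norm_toMulHom] at this
        exact div_le_div_of_nonneg_right this (by positivity)
      -- the exponent
      have a1 : (E0 χ s).re ≤ Lsum + ε := by
        have := Complex.re_le_norm (E0 χ s)
        have := norm_sub_norm_le (E0 χ s) (Lim χ)
        have := hLim_le χ h0
        linarith [h2' χ h0]
      have a2 : -(E0 χs s).re ≤ Lsum + ε := by
        have b := Complex.abs_re_le_norm (E0 χs s)
        have := norm_sub_norm_le (E0 χs s) (Lim χs)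
        have := hLim_le χs hχs0
        have := h2' χs hχs0
        rw [abs_le] at b
        linarith
      have a3 : RB χ s - RB χs s ≤ -(T₀ * hK) + x₁ / 32 + 2 * ε := by
        have b1 : |RB χ s - RB χ 1| < ε :=
          lt_of_le_of_lt (by simp only [hRB]; rw [← sub_re]; exact abs_re_le_norm _) (h3 χ)
        have b2 : |RB χs s - RB χs 1| < ε :=
          lt_of_le_of_lt (by simp only [hRB]; rw [← sub_re]; exact abs_re_le_norm _) (h3 χs)
        have b3 := hRB1 χ
        have b4 := hRB1 χs
        rw [hMainO χ h0 h1 h2''] at b3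
        rw [hMains] at b4
        rw [abs_lt] at b1 b2
        rw [abs_le] at b3 b4
        linarith
      have a4 : -(cπ χ s).re ≤ 6 * xs s := by
        have hx0 := (hxs_pos s).le
        have hxh : xs s ≤ 1 / 2 := by linarith [hx₁le]
        have n1 := norm_locLog_le (huχ1 χ) hx0 hxh (Real.pi / 2)
        have n2 := norm_locLog_le (huχ' χ) hx0 hxh (Real.pi / 2)
        have n3 := norm_locLog_le hus hx0 hxh (Real.pi / 2)
        have n4 := norm_locLog_le hus' hx0 hxh (Real.pi / 2)
        have b := Complex.abs_re_le_norm (cπ χ s)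
        have htri : ‖cπ χ s‖ ≤ ‖ℓf (uχ χ) (xs s) (Real.pi / 2)‖ + ‖ℓf (uχ χ)⁻¹ (xs s) (Real.pi / 2)‖ +
            ‖ℓf us (xs s) (Real.pi / 2)‖ + ‖ℓf us⁻¹ (xs s) (Real.pi / 2)‖ := by
          simp only [hcπ]
          exact (norm_sub_le _ _).trans (add_le_add ((norm_sub_le _ _).trans (add_le_add (norm_add_le _ _) le_rfl)) le_rfl)
        rw [abs_le] at b
        simp only [hℓf] at htri n1 n2 n3 n4
        linarith
      have hRe : (E0 χ s + Bχ χ s - E0 χs s - Bχ χs s - cπ χ s).re ≤ 2 * Lsum + 1 - T₀ * hK := by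
        have e : (E0 χ s + Bχ χ s - E0 χs s - Bχ χs s - cπ χ s).re =
            (E0 χ s).re + RB χ s - (E0 χs s).re - RB χs s - (cπ χ s).re := by
          simp only [add_re, sub_re, hRB]
        rw [e]
        have hsmallnum : 4 * ε + x₁ / 32 + 6 * xs s ≤ 1 := by rw [hε]; linarith [hx₁le, hxs1]
        linarith
      -- exponentiate
      have hexp : Real.exp (2 * Lsum + 1 - T₀ * hK) ≤ |cls χs| / (800 * hK * p₁) := by
        rw [hT₀eq]
        have hpos : 0 < 800 * (hK : ℝ) * p₁ / |cls χs| := by positivity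
        have e : 2 * Lsum + 1 - (2 * Lsum + 2 + Real.log (800 * hK * p₁ / |cls χs|)) =
            -1 - Real.log (800 * hK * p₁ / |cls χs|) := by ring
        rw [e, Real.exp_sub, Real.exp_neg, Real.exp_log hpos]
        have he : (Real.exp 1)⁻¹ ≤ 1 := inv_le_one_of_one_le₀ (by have := Real.add_one_le_exp (1 : ℝ); linarith)
        calc (Real.exp 1)⁻¹ / (800 * hK * p₁ / |cls χs|) = (Real.exp 1)⁻¹ * (|cls χs| / (800 * hK * p₁)) := by
              field_simp
          _ ≤ 1 * (|cls χs| / (800 * hK * p₁)) := by gcongr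
          _ = |cls χs| / (800 * hK * p₁) := one_mul _
      calc ‖kf χ s‖ = ‖((cls χ / c2 : ℝ) : ℂ)‖ * Real.exp ((E0 χ s + Bχ χ s - E0 χs s - Bχ χs s - cπ χ s).re) := by
            simp only [hkf]; rw [norm_mul, Complex.norm_exp]
        _ ≤ (1 / (2 * |cls χs|)) * (|cls χs| / (800 * hK * p₁)) :=
            mul_le_mul hcoef ((Real.exp_le_exp.2 hRe).trans hexp) (Real.exp_pos _).le (by positivity)
        _ = 1 / (1600 * hK * p₁) := by field_simp; ring
    calc ∑ χ ∈ O, ‖kf χ s‖ ≤ ∑ χ ∈ O, 1 / (1600 * (hK : ℝ) * p₁) := Finset.sum_le_sum hterm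
      _ = O.card * (1 / (1600 * (hK : ℝ) * p₁)) := by rw [Finset.sum_const, nsmul_eq_mul]
      _ ≤ hK * (1 / (1600 * (hK : ℝ) * p₁)) := by gcongr
      _ = x₁ / 1600 := by rw [hx₁]; field_simp
      _ ≤ xs s / 200 := by linarith [h6]
  have hcenter' : ∀ s ∈ Ioc 1 s₁, |(q s).re + μs s| ≤ xs s / 4 := by
    intro s hs
    obtain ⟨h1, h2', h3, h4, h5, h6, h7, -⟩ := hS1 s hs
    -- the designed cancellation
    have hQ : |RB 0 1 - RB χs 1 + Pb| ≤ x₁ / 32 := by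
      have b3 := hRB1 0
      have b4 := hRB1 χs
      rw [hMain0] at b3
      rw [hMains] at b4
      rw [abs_le] at b3 b4 ⊢
      constructor <;> linarith
    -- the differences to the limits
    have d1 : |(E0 0 s - I * (Dr s : ℂ)).re - r₀.re| ≤ ε := by
      rw [← sub_re]; exact (abs_re_le_norm _).trans h1.le
    have d2 : |RB 0 s - RB 0 1| ≤ ε := by
      simp only [hRB]; rw [← sub_re]; exact (abs_re_le_norm _).trans (h3 0).le
    have d3 : |(E0 χs s).re - (Lim χs).re| ≤ ε := by
      rw [← sub_re]; exact (abs_re_le_norm _).trans (h2' χs hχs0).le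
    have d4 : |RB χs s - RB χs 1| ≤ ε := by
      simp only [hRB]; rw [← sub_re]; exact (abs_re_le_norm _).trans (h3 χs).le
    have d5 : |cΛ (xs s) - cΛ x₁| ≤ ε := by
      rw [show cΛ x₁ = (cΛs 1).re from rfl, ← hcΛs_re s, ← sub_re]
      exact (abs_re_le_norm _).trans h4.le
    have d6 : |μs s - μf x₁| ≤ ε := h5.le
    have e : (q s).re + μs s = ((E0 0 s - I * (Dr s : ℂ)).re - r₀.re) + (RB 0 s - RB 0 1) -
        ((E0 χs s).re - (Lim χs).re) - (RB χs s - RB χs 1) - (cΛ (xs s) - cΛ x₁) + (μs s - μf x₁) +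
        (RB 0 1 - RB χs 1 + Pb) := by
      simp only [hq, add_re, sub_re, hκre, hcΛs_re, hRB, hPb]
      ring
    rw [e]
    have hfin : x₁ / 32 + 6 * ε ≤ xs s / 4 := by rw [hε]; linarith [h6]
    rw [abs_le] at hQ d1 d2 d3 d4 d5 d6 ⊢
    constructor <;> linarith
  -- ### the abstract two-parameter zero
  obtain ⟨sz, hsz, φz, hφz, hG0, s', hs', hG1⟩ := exists_zero_phase_family ℓf hℓf_eq hs₁ Dr q xs us hus husre
    O kf uχ (fun χ _ ↦ huχ1 χ) hD' hDr_top hq' hqb' hxs' hx' hk' hsmall' hcenter'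
  -- ### Step 8: the twisted model along the family is `(2/h) · W · G`
  have htoMul_neg : ∀ (χ : AddChar (Additive (ClassGroup (𝓞 K))) ℂ) (g : ClassGroup (𝓞 K)),
      toMulHom (-χ) g = (toMulHom χ g)⁻¹ := fun χ g ↦ by
    rw [toMulHom_apply, toMulHom_apply, AddChar.neg_apply']
  have hu0 : uχ 0 = 1 := by simp only [huχ]; rw [toMulHom_apply, AddChar.zero_apply]
  have huχs : uχ χs = us := rfl
  have hcls0 : cls 0 = 1 := by simp only [hcls]; rw [toMulHom_apply, AddChar.zero_apply, Complex.one_re]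
  have hclsneg : cls (-χs) = cls χs := by
    simp only [hcls]; rw [htoMul_neg, Complex.inv_eq_conj (norm_toMulHom χs kcl), Complex.conj_re]
  have hE0neg : ∀ s, E0 (-χs) s = E0 χs s := fun s ↦ logEuler_twistCoeff_neg h2 χs a₀f s
  have hΛ₁neg : ∀ φ s, Λ₁ (-χs) φ s = Λ₁ χs φ s := fun φ s ↦ by
    simp only [hΛ₁, huχ, htoMul_neg, inv_inv]; ring
  have hBneg : ∀ s, Bχ (-χs) s = Bχ χs s := fun s ↦ by
    simp only [hBχ, hΛp]
    refine Finset.sum_congr rfl fun p _ ↦ ?_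
    rw [htoMul_neg, inv_inv]; ring
  have hΛ₁0 : ∀ φ s, Λ₁ 0 φ s = 2 * ℓf 1 (xs s) φ - 2 * ℓf 1 (xs s) (Real.pi / 2) := fun φ s ↦ by
    simp only [hΛ₁, hu0, inv_one]; ring
  have hmodel : ∀ (φ s : ℝ), 1 < s →
      twistModel ((complMul fun p ↦ cexp (θf φ p * I)).toMonoidHom) A (t - 2 * k) C (s : ℂ) =
        (2 / (hK : ℂ)) * ((((c2 : ℝ) : ℂ) * cexp (E0 χs s + Λ₁ χs φ s + Bχ χs s)) *
          (cexp (I * Dr s + q s + (2 * ℓf 1 (xs s) φ - ℓf us (xs s) φ - ℓf us⁻¹ (xs s) φ)) + 1 +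
            ∑ χ ∈ O, kf χ s * cexp (ℓf (uχ χ) (xs s) φ + ℓf (uχ χ)⁻¹ (xs s) φ - ℓf us (xs s) φ -
              ℓf us⁻¹ (xs s) φ))) := by
    intro φ s hs
    have ha1 : ∀ n, ‖((complMul fun p ↦ cexp (θf φ p * I)).toMonoidHom) n‖ ≤ 1 := norm_complMul_cexp_le _
    rw [twistModel_eq_sum_re h2 b hb hω hD hA hn _ ha1 hs]
    congr 1
    have hcoe : (⇑((complMul fun p ↦ cexp (θf φ p * I)).toMonoidHom) : ℕ → ℂ) =
        ⇑(complMul fun p ↦ cexp (θf φ p * I)) := rfl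
    have hterm : ∀ χ : AddChar (Additive (ClassGroup (𝓞 K))) ℂ,
        ((toMulHom χ (idealClass (Ideal.span {(A : 𝓞 K), b 1 - k}))).re : ℂ) *
          cexp (logEuler (twistCoeff χ ⇑((complMul fun p ↦ cexp (θf φ p * I)).toMonoidHom)) s) =
        ((cls χ : ℝ) : ℂ) * cexp (E0 χ s + Λ₁ χ φ s + Bχ χ s) := fun χ ↦ by
      rw [hcoe, hfact φ χ s hs]
    rw [Finset.sum_congr rfl fun χ _ ↦ hterm χ,
      sum_eq_add_add_add_sum_erase (fun χ ↦ ((cls χ : ℝ) : ℂ) * cexp (E0 χ s + Λ₁ χ φ s + Bχ χ s))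
        hχs0 hnegχs0 (Ne.symm hχsneg)]
    rw [hcls0, hclsneg, hE0neg, hΛ₁neg, hBneg]
    set W : ℂ := ((c2 : ℝ) : ℂ) * cexp (E0 χs s + Λ₁ χs φ s + Bχ χs s) with hW
    -- (i) the principal character
    have hi : W * cexp (I * Dr s + q s + (2 * ℓf 1 (xs s) φ - ℓf us (xs s) φ - ℓf us⁻¹ (xs s) φ)) =
        (((1 : ℝ) : ℝ) : ℂ) * cexp (E0 0 s + Λ₁ 0 φ s + Bχ 0 s) := by
      rw [hW, mul_assoc, ← Complex.exp_add]
      have hexponent : E0 χs s + Λ₁ χs φ s + Bχ χs s +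
          (I * Dr s + q s + (2 * ℓf 1 (xs s) φ - ℓf us (xs s) φ - ℓf us⁻¹ (xs s) φ)) =
          (E0 0 s + Λ₁ 0 φ s + Bχ 0 s) - κ := by
        rw [hΛ₁0]
        simp only [hq, hΛ₁, hcΛs, huχs]
        ring
      rw [hexponent, Complex.exp_sub, hexpκ]
      push_cast
      field_simp
    -- (ii) the boosted pair
    have hii : W * 1 = ((cls χs : ℝ) : ℂ) * cexp (E0 χs s + Λ₁ χs φ s + Bχ χs s) +
        ((cls χs : ℝ) : ℂ) * cexp (E0 χs s + Λ₁ χs φ s + Bχ χs s) := by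
      rw [mul_one, hW, hc2]; push_cast; ring
    -- (iii) the other characters
    have hiii : ∀ χ ∈ O, ((cls χ : ℝ) : ℂ) * cexp (E0 χ s + Λ₁ χ φ s + Bχ χ s) =
        W * (kf χ s * cexp (ℓf (uχ χ) (xs s) φ + ℓf (uχ χ)⁻¹ (xs s) φ - ℓf us (xs s) φ - ℓf us⁻¹ (xs s) φ)) := by
      intro χ _
      simp only [hkf, hW]
      rw [mul_assoc (((cls χ / c2 : ℝ)) : ℂ), mul_mul_mul_comm, ← Complex.exp_add, ← Complex.exp_add]
      have hc : ((c2 : ℝ) : ℂ) * ((cls χ / c2 : ℝ) : ℂ) = ((cls χ : ℝ) : ℂ) := by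
        push_cast
        field_simp
      rw [hc]
      congr 1
      simp only [hΛ₁, hcπ, huχs]
      ring
    rw [mul_add, mul_add, Finset.mul_sum, ← Finset.sum_congr rfl hiii, hi, hii]
    push_cast
    ring
  -- ### conclusion
  refine ⟨θf φz, ⟨sz, hsz.1, ?_⟩, s', hs'.1, ?_⟩
  · rw [hmodel φz sz hsz.1, hG0, mul_zero, mul_zero]
  · rw [hmodel φz s' hs'.1]
    have hK0 : (hK : ℂ) ≠ 0 := by exact_mod_cast (show hK ≠ 0 by omega)
    exact mul_ne_zero (div_ne_zero two_ne_zero hK0)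
      (mul_ne_zero (mul_ne_zero (by exact_mod_cast hc2ne) (Complex.exp_ne_zero _)) hG1)

/-- **Davenport–Heilbronn II, Theorem (with Titchmarsh's `≫ T` count), for the form of a lattice
ideal.** For an imaginary quadratic field `K` (`[K:ℚ] = 2`, integral basis `(1, ω)`, `ω² = m + tω`,
`t² + 4m < −4`) with `h_K` odd and `> 1`, and `A > 0`, `AC = k² − tk − m`: the Epstein zeta function
of `Q = (A, t − 2k, C)` has infinitely many zeros in `σ > 1`, at least `C'·T` of them with
`0 < ℑs ≤ T` for all large `T` — the conclusion of `DavenportHeilbronn1936b_epstein` for `Q`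
("The theorem follows from Lemma 2 by the same application of Kronecker's theorem as was made in
our previous paper": `exists_real_zero_twistModel_of_odd` and
`davenportHeilbronn_conclusion_of_twist_zero`). [cite: DavenportHeilbronn1936b, §6 Theorem]
[cite: Titchmarsh1986, §10.25] -/
theorem davenportHeilbronn_conclusion_of_odd_card (h2 : finrank ℚ K = 2)
    (b : Basis (Fin 2) ℤ (𝓞 K)) (hb : b 0 = 1)
    {t m : ℤ} (hω : b 1 * b 1 = (m : 𝓞 K) + (t : 𝓞 K) * b 1) (hD : t ^ 2 + 4 * m < -4)
    {A k C : ℤ} (hA : 0 < A) (hn : A * C = k ^ 2 - t * k - m)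
    (hodd : Odd (Nat.card (ClassGroup (𝓞 K)))) (hh : 1 < Nat.card (ClassGroup (𝓞 K))) :
    {s : ℂ | 1 < s.re ∧ epsteinZeta (A : ℝ) ((t - 2 * k : ℤ) : ℝ) (C : ℝ) s = 0}.Infinite ∧
      ∃ C' : ℝ, 0 < C' ∧ ∀ᶠ T : ℝ in atTop,
        C' * T ≤ ({s : ℂ | 1 < s.re ∧ 0 < s.im ∧ s.im ≤ T ∧
          epsteinZeta (A : ℝ) ((t - 2 * k : ℤ) : ℝ) (C : ℝ) s = 0}.ncard : ℝ) := by
  have hpos : IsPosDefForm (A : ℝ) ((t - 2 * k : ℤ) : ℝ) (C : ℝ) := isPosDefForm_lattice (by linarith) hA hn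
  obtain ⟨θ, ⟨s₁, hs₁, hz⟩, s₂, hs₂, hnz⟩ := exists_real_zero_twistModel_of_odd h2 b hb hω hD hA hn hodd hh
  have ha : ∀ p : ℕ, p.Prime → ‖((complMul fun p ↦ cexp (θ p * I)).toMonoidHom) p‖ = 1 := fun p hp ↦ by
    show ‖complMul (fun p ↦ cexp (θ p * I)) p‖ = 1
    rw [complMul_prime _ hp, Complex.norm_exp_ofReal_mul_I]
  exact davenportHeilbronn_conclusion_of_twist_zero hpos _ ha (by simpa using hs₁) hz (by simpa using hs₂) hnz

end DHEpstein

end Literature.Barriers.RiemannHypothesis
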